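import Summits.AtomisticToContinuum.BoseEinsteinCondensation.Theorems.BECStronglyRayleighLatticeToPeriodicBridgeCoarseCellDefs
import Literature.MathematicalPhysics.QuantumManyBody.PeriodicBoseGasUpperBoundProofs
import Literature.MathematicalPhysics.QuantumManyBody.BoseGasThermodynamicLimitRuelle
import Literature.MathematicalPhysics.QuantumManyBody.BoseGasDirichletWall

/-!
# Route `BECStronglyRayleigh`, crux `LatticeToPeriodicBridge` (stmt-AtomisticToContinuum-9674),
# line `coarse-cell-lorentzian` — stub S1 `stub_diluteEnergyCeiling`

The dilute energy ceiling along the thermodynamic box sequence `L_N = (N/ρ)^{1/3}` — the only place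
energy enters the line (it feeds the retention factor of the cell-Poincaré stub S2):
for every repulsive finite-range `v` there are `C ≥ 0` and `ρ₁ > 0` such that for `0 < ρ < ρ₁`,
eventually in `N`, `E₀^per(N, L_N) ≤ C ρ N`. This is LSSY 2005 Thm 2.2 (2.14) (proved in the tree:
`LSSY2005_upperBound_periodic_holds`) read at `L = L_N`, where `ρ₁' = (N-1)/L_N³ ≤ ρ` and
`a/b = a(4πρ₁'/3)^{1/3} ≤ a(4πρ/3)^{1/3} ≤ c'` once `ρ < 3c'³/(4π(a+1)³)`; `a = scatteringLength v < ∞`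
for finite range (`scatteringLength_ne_top_of_finiteRange`, hard cores included); `N ≥ 2` and
`2R₀ < L_N` eventually (`L_N → ∞`).

The statement `Sig.stub_diluteEnergyCeiling` is the registered stub signature of the line's `Defs`
module; this file provides its witness `stub_diluteEnergyCeiling` (landed `--supports` the crux).

## References

* [LSSY2005] E. H. Lieb, R. Seiringer, J. P. Solovej, J. Yngvason, *The Mathematics of the Bose
  Gas and its Condensation*, Oberwolfach Seminars 34, Birkhäuser 2005: Thm. 2.2 (2.14); App. C, Remark 2.
-/

noncomputable section

open MeasureTheory Filter
open scoped ENNReal Topology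

namespace Summit.AtomisticToContinuum.BoseEinsteinCondensation.Cruxes.LatticeToPeriodicBridge.CoarseCellLorentzian

open Literature.MathematicalPhysics.QuantumManyBody.BoseGas

/-- `a / x^{-1/3} = a · x^{1/3}` for `x ≥ 0` (LSSY's `a/b` with `b = (4πρ₁/3)^{-1/3}`). [folklore] -/
private theorem div_rpow_neg_third_aux {a x : ℝ} (hx : 0 ≤ x) :
    a / x ^ (-(1 : ℝ) / 3) = a * x ^ ((1 : ℝ) / 3) := by
  rw [show (-(1 : ℝ) / 3) = -((1 : ℝ) / 3) by ring, Real.rpow_neg hx, div_inv_eq_mul]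

/-- The density threshold: for `0 ≤ a`, `0 < c` and `0 ≤ ρ < 3c³/(4π(a+1)³)` one has
`a (4πρ/3)^{1/3} ≤ c` (as `t = (4πρ/3)^{1/3}` has `t³ < (c/(a+1))³`, so `a t ≤ (a+1) t ≤ c`). [folklore] -/
private theorem mul_rpow_third_le_aux {a c ρ : ℝ} (ha : 0 ≤ a) (hc : 0 < c) (hρ : 0 ≤ ρ)
    (hρ₁ : ρ < 3 * c ^ 3 / (4 * Real.pi * (a + 1) ^ 3)) :
    a * (4 * Real.pi * ρ / 3) ^ ((1 : ℝ) / 3) ≤ c := by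
  set t : ℝ := (4 * Real.pi * ρ / 3) ^ ((1 : ℝ) / 3) with ht
  have ht0 : 0 ≤ t := Real.rpow_nonneg (by positivity) _
  have ht3 : t ^ 3 = 4 * Real.pi * ρ / 3 := by
    rw [ht, show ((1 : ℝ) / 3) = ((3 : ℕ) : ℝ)⁻¹ by norm_num,
      Real.rpow_inv_natCast_pow (by positivity) three_ne_zero]
  have ha1 : 0 < a + 1 := by linarith
  have hlt : t ^ 3 < (c / (a + 1)) ^ 3 := by
    rw [ht3, div_pow, lt_div_iff₀ (by positivity)]
    rw [lt_div_iff₀ (by positivity)] at hρ₁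
    linarith
  have htc : t < c / (a + 1) := lt_of_pow_lt_pow_left₀ 3 (by positivity) hlt
  calc a * t ≤ (a + 1) * t := by nlinarith
    _ ≤ (a + 1) * (c / (a + 1)) := by gcongr
    _ = c := by field_simp

/-- **S1 — dilute energy ceiling**: for every repulsive finite-range `v` there are `C ≥ 0` and
`ρ₁ > 0` such that for `0 < ρ < ρ₁`, eventually in `N`, `E₀^per(N, L_N) ≤ C ρ N`
(`L_N = (N/ρ)^{1/3}`), with `C = 4πa(1 + C'c')` from the constants `C', c'` of
`LSSY2005_upperBound_periodic` and `ρ₁ = 3c'³/(4π(a+1)³)`, `a = scatteringLength v`.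
Proof: LSSY Thm 2.2 (2.14) at `L = L_N` (`N ≥ 2`, `2R₀ < L_N` eventually since `L_N → ∞`),
`ρ₁' = (N-1)/L_N³ ≤ N/L_N³ = ρ` and `a/b = a(4πρ₁'/3)^{1/3} ≤ a(4πρ/3)^{1/3} ≤ c'`.
[LSSY2005 Thm 2.2 (2.14); App. C Remark 2] -/
theorem stub_diluteEnergyCeiling : Sig.stub_diluteEnergyCeiling := by
  intro v hv
  obtain ⟨hmeas, R₀, hR₀⟩ := hv
  have hfin : scatteringLength v ≠ ⊤ := scatteringLength_ne_top_of_finiteRange hR₀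
  obtain ⟨C, c, hC, hc, H⟩ := LSSY2005_upperBound_periodic_holds v R₀ hmeas hR₀ hfin
  set a : ℝ := (scatteringLength v).toReal with ha_def
  have ha0 : 0 ≤ a := ENNReal.toReal_nonneg
  refine ⟨4 * Real.pi * a * (1 + C * c), by positivity,
    3 * c ^ 3 / (4 * Real.pi * (a + 1) ^ 3), by positivity, fun ρ hρ hρ₁ => ?_⟩
  have hkey : a * (4 * Real.pi * ρ / 3) ^ ((1 : ℝ) / 3) ≤ c :=
    mul_rpow_third_le_aux ha0 hc hρ.le hρ₁
  filter_upwards [eventually_ge_atTop 2,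
    (tendsto_sideLength_atTop hρ).eventually_gt_atTop (2 * R₀)] with N h2 hRL
  have hN0 : 0 < N := lt_of_lt_of_le two_pos h2
  have hNr : (0 : ℝ) < N := Nat.cast_pos.2 hN0
  set L : ℝ := sideLength ρ N with hL_def
  have hL : 0 < L := sideLength_pos_of_pos hρ hN0
  have hL3 : L ^ 3 = N / ρ := sideLength_pow_three hρ N
  -- the reduced density `ρ₁' = (N-1)/L³ ≤ ρ`
  set ρ' : ℝ := ((N : ℝ) - 1) / L ^ 3 with hρ'_def
  have hN1 : (0 : ℝ) ≤ (N : ℝ) - 1 := by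
    have : (1 : ℝ) ≤ N := by exact_mod_cast hN0
    linarith
  have hρ'0 : 0 ≤ ρ' := div_nonneg hN1 (pow_nonneg hL.le 3)
  have hρ'le : ρ' ≤ ρ := by
    rw [hρ'_def, hL3, div_le_iff₀ (div_pos hNr hρ), mul_div_assoc', le_div_iff₀ hρ]
    nlinarith
  have hx0 : 0 ≤ 4 * Real.pi * ρ' / 3 := by positivity
  -- `a/b ≤ c`
  have hab : a * (4 * Real.pi * ρ' / 3) ^ ((1 : ℝ) / 3) ≤ c := by
    refine le_trans (mul_le_mul_of_nonneg_left (Real.rpow_le_rpow hx0 ?_ (by norm_num)) ha0) hkey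
    gcongr
  have hL1 := H N L h2 hL hRL
  simp only [] at hL1
  have hab' : a / (4 * Real.pi * (((N : ℝ) - 1) / L ^ 3) / 3) ^ (-(1 : ℝ) / 3) ≤ c := by
    rw [div_rpow_neg_third_aux hx0]
    exact hab
  have hL2 := hL1 hab'
  rw [div_rpow_neg_third_aux hx0] at hL2
  -- `E₀ ≤ 4πρ₁'a(1 + C a/b)N ≤ 4πa(1 + Cc) ρ N`
  refine hL2.trans (ENNReal.ofReal_le_ofReal ?_)
  calc 4 * Real.pi * ρ' * a * (1 + C * (a * (4 * Real.pi * ρ' / 3) ^ ((1 : ℝ) / 3))) * N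
      ≤ 4 * Real.pi * ρ * a * (1 + C * c) * N := by gcongr
    _ = 4 * Real.pi * a * (1 + C * c) * ρ * N := by ring

end Summit.AtomisticToContinuum.BoseEinsteinCondensation.Cruxes.LatticeToPeriodicBridge.CoarseCellLorentzian

end
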